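import Mathlib.CategoryTheory.SingleObj
import Summits.ABC.IUTFork.Cor312NaivePadicBalls
import Summits.ABC.IUTFork.Thm311LinkCompat
import HarnessLib

/-!
# The naive `p`-adic model for the Cor. 3.12 adjudication, II: the typed [IUTchIII] Theorem 3.11 holds, contentfully

Record-only file (D-0012) of the abc-iut cell (D-0067, ADJUDICATION-SPEC §2 (G3) / §4 (iii), «G-NV»; seat
abc-iut-w5-d247); TAKES NO SIDE.  Part II of three.  A1's `GapWitness.gapFull` and abc-iut-w4-d026's
`GapWitnessProv.full` satisfy c312-1's typed Thm. 3.11 (`Thm311.FullSituation.Statement`) on DEGENERATE data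
(`Ψ = ∅`, `M_mod = ∅`, unit images = packet, identity Kummer transport, one-object link data).  Here the typed
Thm. 3.11 (i) ∧ (ii) ∧ (iii) is proved (`naiveFull_statement`) for the NAIVE `p`-ADIC MODEL, whose data are
contentful in every slot the signature offers:
* (i)(a) `naiveData`: integral structures the unit balls `B_0` (PROPER), admissible regions the balls,
  log-volume `μ(B_k) = −k·log p`; (i)(b) splitting monoids `Psi = {(±q^{j²})_{j ∈ 𝔽_l^⋇}}`, `q := p` — the
  torsion-translates of NONZERO theta values (`thetaValues_mem_Psi`, `zero_notMem_Psi`), inside the sub-packets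
  (`subPacket_eq_top`), acting by coordinatewise multiplication; (i)(c) `naiveDegrees`: objects `p^k𝒪`, `k ∈ ℤ`,
  degree `−k·log p` = the global log-volume of the region `B_k` (the degree clause, non-trivially);
* (ii) `naiveColumn`: the Frobenius-like data at `(n,m)` are the coric data transported by the TWIST
  `(−1)^m ∈ Ism` (`twist`; abc-iut-w4-d101's `negFamily` at odd `m`, which moves points): KummerA ⟸ the twist
  fixes balls, KummerB ⟸ `Ψ_v` is torsion-saturated (`image_Psi_of_actsBySigns`), KummerC ⟸ the twist is onto;
  (Ind3): unit-group images at iterate `m'` the balls `B_{m'+1} ⊊ B_0`, shrinking with `m'`; Frobenius-like /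
  étale-like Frobenioid objects on DISTINCT carriers (`FrobObj m`, `ℤ`) with the forgetful Kummer bijection `kum`;
* (iii) `naiveLink`: link data over the one-object groupoid of `ℤˣ` — Kummer isomorphism `κ_{n,m} = (−1)^m`,
  natural isomorphism `−1`, theater automorphisms `ℤˣ` inducing NON-identity automorphisms
  (`unitIso_neg_one_ne_refl`), equivariance a genuine commutation; permutation poly-isomorphisms full.
HONEST SCOPE: a model of the typed signatures, not of the intended objects; (i)'s multiradial compatibility holds
because the data of all vertical lines coincide (bi-coric strictification).  No judgement on print; no `Prop`
fact; standard axioms. [claim: Mochizuki2012, status: disputed] [cite: ScholzeStix2018, §2.2 pp. 9–10]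
-/

noncomputable section

namespace Summit.ABC

namespace IUTFork

namespace Cor312Vol

namespace NaiveWitness

open Thm311 Cor312 Cor312.Checks Cor312.IdentifiedNonVacuity Literature.IUT.LogThetaLattice

variable (p : ℕ)

/-! ## 4. The data (a)(b)(c), the column with its sign-twisted Kummer transport, the link data -/

section Model

variable [hp : Fact p.Prime]

/-- The Kummer TWIST at lattice position `m`: the identity for even `m`, the (Ind2)-family "`−1` on every
summand of every factor" (abc-iut-w4-d101's `negFamily`) for odd `m` — an element of Ism, not the identity.
[claim: Mochizuki2012, status: disputed] -/
def twist (m : ℤ) : signShells.PacketAut := if Even m then 1 else negFamily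

omit hp in
/-- The twist acts by signs. [folklore] -/
theorem twist_actsBySigns (m : ℤ) : ActsBySigns (twist m) := by
  unfold twist
  split_ifs
  · exact actsBySigns_one
  · exact actsBySigns_of_mem_Ind2Family negFamily_mem_Ind2Family

omit hp in
/-- The twist fixes every ball. [folklore] -/
theorem image_pBall_twist (m : ℤ) (j : toyIndex.Label) (vQ : toyIndex.VQ) (k : ℤ) :
    twist m j vQ '' pBall p j vQ k = pBall p j vQ k :=
  image_pBall_of_actsBySigns p (twist_actsBySigns m) j vQ k

/-- The SPLITTING MONOID at the bad place: the torsion-translates `(±q^{j²})_{j ∈ 𝔽_l^⋇}` of the tuple of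
theta values, `q := p` ([IUTchIII] Thm. 3.11 (i) (b); Prop. 3.5 (ii) (c): the theta values `q^{j²}`).
[claim: Mochizuki2012, status: disputed] -/
def Psi (v : toyIndex.V) : Set (signShells.StarPacket v) :=
  {f | ∀ j : toyIndex.LabelStar,
    line j.1 (toyIndex.over v) (f j) = (p : ℚ) ^ ((j.1 : ℕ) ^ 2) ∨
      line j.1 (toyIndex.over v) (f j) = -(p : ℚ) ^ ((j.1 : ℕ) ^ 2)}

/-- The tuple of theta values `(q^{j²})_j` itself. [claim: Mochizuki2012, status: disputed] -/
def thetaValues (v : toyIndex.V) : signShells.StarPacket v :=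
  fun j => (line j.1 (toyIndex.over v)).symm ((p : ℚ) ^ ((j.1 : ℕ) ^ 2))

omit hp in
/-- The theta values lie in the splitting monoid (which is therefore NONEMPTY). [folklore] -/
theorem thetaValues_mem_Psi (v : toyIndex.V) : thetaValues p v ∈ Psi p v :=
  fun _ => Or.inl (LinearEquiv.apply_symm_apply _ _)

/-- `0 ∉ Ψ_v`: the splitting monoid is not the degenerate `{0}`. [folklore] -/
theorem zero_notMem_Psi (v : toyIndex.V) : (0 : signShells.StarPacket v) ∉ Psi p v := by
  intro h
  have h1 := h ⟨1, by decide⟩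
  have h0 : (0 : signShells.StarPacket v) ⟨1, by decide⟩ = 0 := rfl
  rw [h0, map_zero] at h1
  have hne : ((p : ℚ) ^ (((1 : toyIndex.Label) : ℕ) ^ 2)) ≠ 0 :=
    pow_ne_zero _ (Nat.cast_ne_zero.mpr hp.out.ne_zero)
  rcases h1 with h1 | h1
  · exact hne h1.symm
  · exact hne (neg_eq_zero.1 h1.symm)

omit hp in
/-- **A family acting by signs maps `Ψ_v` onto itself** (the Kummer transport of the Frobenius-like
splitting monoid IS the coric one because `Ψ_v` is torsion-saturated — not by `rfl`). [folklore] -/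
theorem image_Psi_of_actsBySigns {Φ : signShells.PacketAut} (h : ActsBySigns Φ) (v : toyIndex.V) :
    signShells.starAut Φ v '' Psi p v = Psi p v := by
  have key : ∀ f : signShells.StarPacket v, signShells.starAut Φ v f ∈ Psi p v ↔ f ∈ Psi p v := by
    intro f
    refine forall_congr' fun j => ?_
    obtain ⟨ε, hε, hΦ⟩ := h.sign j.1 (toyIndex.over v)
    show (line j.1 _ (Φ j.1 _ (f j)) = _ ∨ line j.1 _ (Φ j.1 _ (f j)) = _) ↔ _
    rw [hΦ]
    rcases (abs_eq (zero_le_one' ℚ)).1 hε with rfl | rfl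
    · rw [one_mul]
    · rw [neg_one_mul, neg_inj, neg_eq_iff_eq_neg, or_comm]
  apply Set.Subset.antisymm
  · rintro _ ⟨f, hf, rfl⟩; exact (key f).2 hf
  · intro f hf
    exact ⟨(signShells.starAut Φ v).symm f, (key _).1 (by rwa [LinearEquiv.apply_symm_apply]),
      LinearEquiv.apply_symm_apply _ _⟩

omit hp in
/-- Over the one-place index every pure tensor has its last factor supported at the only valuation, so the
sub-packet `𝓘^ℚ(^{S^±_{j+1},j};𝒟^⊢_v)` is the whole packet. [folklore] -/
theorem subPacket_eq_top (j : toyIndex.Label) (v : toyIndex.V) : signShells.SubPacket j v = ⊤ := by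
  haveI : Subsingleton toyIndex.V := inferInstanceAs (Subsingleton Unit)
  refine top_unique fun x _ => ?_
  have hx : x ∈ Submodule.span ℚ (Set.range (PiTensorProduct.tprod ℚ
      (s := fun _ : toyIndex.Caps j => signShells.Packet1 (toyIndex.over v)))) := by
    rw [PiTensorProduct.span_tprod_eq_top]; trivial
  refine Submodule.span_mono ?_ hx
  rintro _ ⟨y, rfl⟩
  exact ⟨y, fun w hw => absurd (Subsingleton.elim _ _) hw, rfl⟩

/-- **The data (a)(b)(c) of the naive model** ([IUTchIII] Thm. 3.11 (i)): integral structures the unit balls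
`B_0` (PROPER), admissible regions the balls, log-volume `μ(B_k) = −k·log p`; splitting monoids `Ψ_v`
acting by coordinatewise multiplication; number-field copy the whole global packet.
[claim: Mochizuki2012, status: disputed] -/
def naiveData : MRData signShells where
  shellPk := fun j vQ => pBall p j vQ 0
  shellSub := fun j v => pBall p j (toyIndex.over v) 0
  Adm := fun j vQ A => ∃ k, A = pBall p j vQ k
  logvol := fun j vQ A => pVol p j vQ A
  Ψ := fun v _ => Psi p v
  act := fun v _ y => LinearMap.pi fun j => (line j.1 (toyIndex.over v) (y j)) • LinearMap.proj j
  Mmod := fun _ => Set.univ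

/-- **(c)'s global realified Frobenioids in the naive model**: objects the fractional ideals `p^k𝒪`, `k ∈ ℤ`
(Frobenius-like and étale-like copies identified by the identity), degree `−k·log p`, region the ball `B_k`.
[claim: Mochizuki2012, status: disputed] -/
def naiveDegrees (j : toyIndex.LabelStar) : GlobalDegrees signShells j where
  ObjMOD := ℤ
  Objmod := ℤ
  natIso := Equiv.refl ℤ
  deg := fun k => -(k : ℝ) * Real.log p
  region := fun k vQ => pBall p j.1 vQ k

/-- The naive SITUATION: sign shells, the same data on every vertical line (the bi-coric strictification).
(An `abbrev`, so that `(naiveSituation p).L` reduces to `signShells`.) [claim: Mochizuki2012, status: disputed] -/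
abbrev naiveSituation : Situation toyIndex where
  L := signShells
  D := fun _ => naiveData p
  G := fun _ j => naiveDegrees p j

/-- The Frobenius-like objects of `^{n,m}𝒞^⊩` (a carrier TAGGED by the lattice coordinate `m`, distinct from
the coric carrier `ℤ`). [claim: Mochizuki2012, status: disputed] -/
def FrobObj (m : ℤ) : Type := {z : ℤ × ℤ // z.2 = m}

/-- The Kummer bijection `^{n,m}𝒞^⊩ ⥲ 𝒞^⊩(^{n,∘})` on objects: forget the tag.
[claim: Mochizuki2012, status: disputed] -/
def kum (m : ℤ) : FrobObj m ≃ ℤ where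
  toFun z := z.1.1
  invFun k := ⟨(k, m), rfl⟩
  left_inv z := by
    rcases z with ⟨⟨a, b⟩, hb⟩
    cases hb
    rfl
  right_inv k := rfl

/-- **The column `n` of the naive model** ([IUTchIII] Thm. 3.11 (ii)): the Frobenius-like data at `(n,m)` read
on the coric packets through the Kummer isomorphism TWISTED by `(−1)^m ∈ Ism` — admissibility/log-volume,
splitting monoid and number field are the twisted transports of the coric ones; unit-group images at iterate
`m'` the balls `B_{m'+1}` (shrinking), arch ball images `B_0`; Frobenioid objects tagged copies of `ℤ` with the
forgetful Kummer bijections; Θ-pilot the object of index `1`. [claim: Mochizuki2012, status: disputed] -/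
def naiveColumn : Column signShells where
  frobAdm := fun m j vQ A => ∃ k, twist m j vQ '' A = pBall p j vQ k
  frobLogvol := fun m j vQ A => pVol p j vQ (twist m j vQ '' A)
  frobΨ := fun m v _ => signShells.starAut (twist m) v '' Psi p v
  frobMmod := fun m j => signShells.globalAut (twist m) j.1 '' Set.univ
  unitImage := fun _ m' j vQ => pBall p j vQ ((m' : ℤ) + 1)
  ballImage := fun _ j vQ => pBall p j vQ 0
  ObjLGP := ℤ
  frobObjLGP := FrobObj
  kumLGP := kum
  ObjLgp := ℤ
  frobObjLgp := FrobObj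
  kumLgp := kum
  thetaPilot := fun m => ⟨(1, m), rfl⟩

/-- The isomorphism of the one-object groupoid of `ℤˣ` given by a unit. [folklore] -/
def unitIso (g : ℤˣ) : (CategoryTheory.SingleObj.star ℤˣ) ≅ (CategoryTheory.SingleObj.star ℤˣ) where
  hom := g
  inv := (g⁻¹ : ℤˣ)
  hom_inv_id := by rw [CategoryTheory.SingleObj.comp_as_mul]; exact inv_mul_cancel g
  inv_hom_id := by rw [CategoryTheory.SingleObj.comp_as_mul]; exact mul_inv_cancel g

omit hp in
/-- Composition of unit isomorphisms is (reversed) multiplication. [folklore] -/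
theorem unitIso_trans (g h : ℤˣ) : unitIso g ≪≫ unitIso h = unitIso (h * g) :=
  CategoryTheory.Iso.ext rfl

omit hp in
/-- `unitIso (−1)` is NOT the identity. [folklore] -/
theorem unitIso_neg_one_ne_refl : unitIso (-1) ≠ CategoryTheory.Iso.refl _ := by
  intro h
  have h1 : ((-1 : ℤˣ) : ℤˣ) = 1 := congrArg CategoryTheory.Iso.hom h
  exact absurd h1 (by decide)

/-- **The link data of the naive model** ([IUTchIII] Thm. 3.11 (iii)) over the one-object groupoid of `ℤˣ`:
Kummer isomorphism `κ_{n,m} := (−1)^m`, natural isomorphism `−1`, permutation-symmetry poly-isomorphisms full,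
theater automorphisms `ℤˣ` inducing the corresponding (non-identity for `−1`) automorphisms everywhere.
[claim: Mochizuki2012, status: disputed] -/
def naiveLink : LinkData where
  Strip := CategoryTheory.SingleObj ℤˣ
  Fdelta := fun _ _ => CategoryTheory.SingleObj.star ℤˣ
  FdeltaD := fun _ => CategoryTheory.SingleObj.star ℤˣ
  kumDelta := fun _ m => unitIso ((-1) ^ m.natAbs)
  FenvD := fun _ => CategoryTheory.SingleObj.star ℤˣ
  natEnvD := fun _ => unitIso (-1)
  Rad := CategoryTheory.SingleObj ℤˣ
  R := fun _ => CategoryTheory.SingleObj.star ℤˣ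
  permR := fun _ => Literature.IUT.HodgeTheaters.PolyIso.full _ _
  Kap := CategoryTheory.SingleObj ℤˣ
  Mk := fun _ => CategoryTheory.SingleObj.star ℤˣ
  permM := fun _ => Literature.IUT.HodgeTheaters.PolyIso.full _ _
  AutHT := fun _ _ => ℤˣ
  onDelta := fun _ _ a => unitIso a
  onDeltaD := fun _ _ a => unitIso a
  onR := fun _ _ a => unitIso a
  onM := fun _ _ a => unitIso a

/-- **The full situation of [IUTchIII] Thm. 3.11 in the naive model** (an `abbrev`: its underlying situation
reduces to `naiveSituation`). [claim: Mochizuki2012, status: disputed] -/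
abbrev naiveFull : FullSituation toyIndex where
  toSituation := naiveSituation p
  col := fun _ => naiveColumn p
  link := naiveLink

/-! ## 5. The typed Theorem 3.11 (i) ∧ (ii) ∧ (iii) holds in the naive model -/

/-- (i): the (nonempty) splitting monoids sit in the sub-packets; the degree of `p^k𝒪` IS the global
log-volume `−k·log p` of its region; the classes `^{n,∘}𝔯^{LGP}` coincide (bi-coric strictification).
[folklore] -/
theorem naive_partI : (naiveFull p).PartI := by
  refine ⟨fun n v hv x _ j => ?_, fun n j k => ⟨fun vQ => ⟨k, rfl⟩, Set.toFinite _, ?_⟩, fun _ _ => rfl⟩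
  · show x j ∈ signShells.SubPacket j.1 v
    rw [subPacket_eq_top]; trivial
  · rw [finsum_unique]
    exact (pVol_pBall p j.1 _ k).symm

omit hp in
/-- (ii), column by column: KummerA = Ism-invariance of admissibility and log-volume, KummerB = sign-symmetry
of `Ψ_v`, KummerC = the twist is onto, (Ind3) = `B_{m'+1} ⊆ B_0` (no archimedean place). [folklore] -/
theorem naive_partII : (naiveFull p).toLatticeSituation.PartII := by
  intro n
  refine (Column.partII_iff _ _).2 ⟨?_, fun m v hv => image_Psi_of_actsBySigns p (twist_actsBySigns m) v,
    fun m j => Set.image_univ_of_surjective (signShells.globalAut (twist m) j.1).surjective, ?_⟩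
  · rintro m j vQ A ⟨k, rfl⟩
    exact ⟨⟨k, image_pBall_twist p m j vQ k⟩, by
      show pVol p j vQ (twist m j vQ '' pBall p j vQ k) = pVol p j vQ (pBall p j vQ k)
      rw [image_pBall_twist]⟩
  · refine ⟨fun m m' j vQ _ => pBall_mono p j vQ (by omega), fun m j vQ h => absurd trivial h⟩

/-- (iii): squares of full poly-isomorphisms commute; the Kummer isomorphism `(−1)^m` is equivariant for the
`ℤˣ`-automorphisms (an abelian commutation); full permutation poly-isomorphisms are stabilized. [folklore] -/
theorem naive_partIII : (naiveFull p).PartIII := by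
  refine ⟨naiveLink.partIIIa_holds, naiveLink.partIIIb_holds, ?_, ?_,
    (naiveFull p).evalCompatUpToInd_of_multiradialCompat (naive_partI p).2.2⟩
  · refine naiveLink.partIIIc_of_full (fun _ => rfl) fun n m => ?_
    rintro _ ⟨a, rfl⟩
    show unitIso a ≪≫ unitIso ((-1) ^ m.natAbs) = unitIso ((-1) ^ m.natAbs) ≪≫ unitIso a
    rw [unitIso_trans, unitIso_trans, mul_comm]
  · intro n m; exact Thm311.PolyIsoCalc.stabilized_full _ _

/-- **The typed Theorem 3.11 (i) ∧ (ii) ∧ (iii) HOLDS in the naive model.** [folklore] -/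
theorem naiveFull_statement : (naiveFull p).Statement := ⟨naive_partI p, naive_partII p, naive_partIII p⟩

end Model

end NaiveWitness

end Cor312Vol

end IUTFork

end Summit.ABC

end
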